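import Summits.NavierStokesRegularity.NavierStokesRegularity.Theorems.NoOverheating.Negative.ExcludedStrataCensusV8
import Summits.NavierStokesRegularity.NavierStokesRegularity.Theorems.NoOverheating.Negative.VanishingAngleSymmetryWindowsExcluded

/-!
# KJ-61 — CENSUS v9 of the excluded strata of route `AngularGalerkinLadder`'s window sequences
# ((S0)–(S20) of `excludedStrata_windowSequences_v8` + (S21) rotation invariance under VANISHING
# angles about moving axes — `N`-fold wave patterns need bounded wave numbers)

Refuter lineage, Negative lane of crux K2 `NoOverheating` (supports, does not decide).  Pure
assembly — this file proves NOTHING new: it folds kernel row KJ-60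
(`VanishingAngleSymmetryWindowsExcluded`) into the census statement of record,
`excludedStrata_windowSequences_v9`, "what an admissible window sequence of K2 can NOT be":

* (S21) for some frames `Aₙ` and angles `αₙ ≠ 0` with `αₙ → 0`, every slice `uₙ(t, ·)`, `t < 0`,
  commutes in the frame `Aₙ` with the rotation by `αₙ` about `e₃` (e.g. `C_{Nₙ}`-symmetric
  profiles — zonal mean plus an `Nₙ`-fold azimuthal wave — with `Nₙ → ∞`): the integer multiples
  of `αₙ` densify, the ladder limit of a subsequence with convergent frames is axisymmetric, and
  KNSS 2009 Thm. 5.3 kills it,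
  `…VanishingAngleSymmetryExcluded.no_windowSequence_rotInvariant_vanishingAngle`.

Census sentence after v9: as v8, and moreover an `N`-fold-symmetric supply must keep its wave
number BOUNDED along the ladder (a `C_N`-symmetric limit with fixed `N ≥ 2` is excluded by nothing
in print).
[cite: KochNadirashviliSereginSverak2009, Thm. 5.3 and §6 (axisymmetric Type-I Liouville); Lemma 6.1 (limits of rescaled solutions)] -/

namespace Summit.NavierStokesRegularity.AngularGalerkinLadderExcludedStrataCensusV9

open Set Filter MeasureTheory Topology Function
open scoped ENNReal
open Literature.Analysis Literature.Analysis.FluidPDE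
open Summit.NavierStokesRegularity.FluidComputer
open Summit.NavierStokesRegularity.NavierStokesRegularity.Theses.AngularGalerkinLadder
open Summit.NavierStokesRegularity.AngularGalerkinLadderExcludedStrataCensusV8
open Summit.NavierStokesRegularity.AngularGalerkinLadderVanishingAngleSymmetryExcluded

/-- **Census theorem v9: the excluded strata (S0)–(S21) of K2's window sequences.**  As
`excludedStrata_windowSequences_v8`, plus (S21): rotation invariance of every slice under angles
`αₙ ≠ 0`, `αₙ → 0`, about moving axes `Aₙ e₃` — for ANY window `1 < cmin ≤ cmax` and ANY rotations.
[cite: KochNadirashviliSereginSverak2009, Thm. 5.3 and §6 (axisymmetric Type-I Liouville); Lemma 6.1 (limits of rescaled solutions)] -/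
theorem excludedStrata_windowSequences_v9 :
    ∃ ε₀ : ℝ, 0 < ε₀ ∧ ∀ C₀ : ℝ, ∃ κ α₁ c₁ α₂ c₂ lam₁ β₁ β₂ : ℝ,
      1 < κ ∧ 0 < α₁ ∧ 1 < c₁ ∧ 0 < α₂ ∧ 1 < c₂ ∧ 1 < lam₁ ∧ 0 < β₁ ∧ 0 < β₂ ∧
      ∀ {cmin cmax δ : ℝ} {L : ℕ → ℕ} {ε c : ℕ → ℝ}
        {R : ℕ → (EuclideanSpace ℝ (Fin 3) ≃ₗᵢ[ℝ] EuclideanSpace ℝ (Fin 3))}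
        {u : ℕ → ℝ → EuclideanSpace ℝ (Fin 3) → EuclideanSpace ℝ (Fin 3)}
        {p : ℕ → ℝ → EuclideanSpace ℝ (Fin 3) → ℝ}
        {d : ℕ → ℝ → EuclideanSpace ℝ (Fin 3) → EuclideanSpace ℝ (Fin 3)},
        1 < cmin → 0 < δ → Tendsto ε atTop (𝓝 0) →
        (∀ n, AngularLadder.IsWindowProfile (L n) C₀ cmin cmax δ (ε n) (c n) (R n) (u n) (p n)
          (d n)) →
        ¬ (C₀ ≤ ε₀ ∨
           (∀ n, ∀ t < 0, IsAxisymmetric (u n t)) ∨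
           (∃ q : ℕ, 0 < q ∧ cmax ^ q < κ ∧
              ∀ x, Tendsto (fun n => ((R n) ^ q) x) atTop (𝓝 x)) ∨
           (∃ (q : ℕ) (g : ℕ → (EuclideanSpace ℝ (Fin 3) ≃ₗᵢ[ℝ] EuclideanSpace ℝ (Fin 3)))
              (θ : ℕ → ℝ),
              0 < q ∧ cmax ^ q < c₁ ∧ (∀ n x, ((R n) ^ q) x = g n (rotZ (θ n) ((g n).symm x))) ∧
              ∀ n, |θ n| ≤ 2 * α₁ * (q * Real.log (c n))) ∨
           (∃ (Θ ℓ : ℝ) (g : ℕ → (EuclideanSpace ℝ (Fin 3) ≃ₗᵢ[ℝ] EuclideanSpace ℝ (Fin 3)))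
              (θ : ℕ → ℝ),
              ℓ < Real.log c₂ ∧ (∀ n x, R n x = g n (rotZ (θ n) ((g n).symm x))) ∧
              (∀ n, |θ n| ≤ Θ) ∧ (∀ n, 2 * α₂ * Real.log (c n) ≤ |θ n|) ∧
              ∀ n, (1 + (θ n / (2 * Real.log (c n))) ^ 2) * Real.log (c n) ≤ ℓ) ∨
           (∃ lam : ℝ, 1 < lam ∧ lam < lam₁ ∧ ∀ n, IsDiscretelySelfSimilar lam (u n)) ∨
           (∀ n, IsSelfSimilar (u n)) ∨
           (∃ (g : ℕ → (EuclideanSpace ℝ (Fin 3) ≃ₗᵢ[ℝ] EuclideanSpace ℝ (Fin 3))) (α : ℕ → ℝ),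
              (∀ n (μ : ℝ), 1 < μ → IsRotatedDSS μ
                (((g n).symm.trans (rotZLIE (2 * α n * Real.log μ))).trans (g n)) (u n)) ∧
              ∀ n, |α n| ≤ β₁ ∨ β₂ ≤ |α n|) ∨
           (∃ M : ℝ≥0∞, M < ⊤ ∧ ∀ n, eLpNorm (u n (-1)) 3 volume ≤ M) ∨
           (∃ M : ℝ≥0∞, M < ⊤ ∧ ∀ n, eLpNorm (u n (-1)) 2 volume ≤ M) ∨
           (∀ η : ℝ, 0 < η → ∃ ρ : ℝ, ∀ n x, ρ ≤ ‖x‖ → ‖x‖ * ‖u n (-1) x‖ ≤ η) ∨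
           (∀ n, ∀ t < 0, ∃ e : EuclideanSpace ℝ (Fin 3), ∀ x,
              curl (u n t) x = ‖curl (u n t) x‖ • e) ∨
           (∀ n, ∃ (d₀ : ℝ) (η : ℝ → ℝ), Tendsto η (𝓝[>] 0) (𝓝 0) ∧
              ∀ s ∈ Ioo (-1 : ℝ) 0, ∀ x y, d₀ < ‖curl (u n s) x‖ → d₀ < ‖curl (u n s) y‖ →
                ‖vorticityDirection (curl (u n s)) x - vorticityDirection (curl (u n s)) y‖ ≤
                  η ‖x - y‖) ∨
           (∃ (n : ℕ) (S : EuclideanSpace ℝ (Fin 3) ≃ₗᵢ[ℝ] EuclideanSpace ℝ (Fin 3))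
              (b : EuclideanSpace ℝ (Fin 3)), S b = b ∧ b ≠ 0 ∧
              ∀ x, ‖u n (-1) (S x + b)‖ = ‖u n (-1) x‖) ∨
           (∃ (n : ℕ) (ρ B : ℝ), 0 < ρ ∧
              ∀ z ∈ parabolicCylinder ρ (0 : ℝ × EuclideanSpace ℝ (Fin 3)), ‖u n z.1 z.2‖ ≤ B) ∨
           (∃ (n : ℕ) (U : EuclideanSpace ℝ (Fin 3) → EuclideanSpace ℝ (Fin 3)),
              Continuous U ∧ ∀ t < 0, u n t = U) ∨
           (∃ (n : ℕ) (e : EuclideanSpace ℝ (Fin 3)), ∀ x, ∃ a : ℝ,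
              curl (u n (-1)) x = a • e) ∨
           (∃ (n : ℕ) (d₀ : ℝ) (η : ℝ → ℝ), Tendsto η (𝓝[>] 0) (𝓝 0) ∧
              ∀ s ∈ Ioo (-1 : ℝ) 0, ∀ x y, d₀ < ‖curl (u n s) x‖ → d₀ < ‖curl (u n s) y‖ →
                min ‖vorticityDirection (curl (u n s)) x - vorticityDirection (curl (u n s)) y‖
                    ‖vorticityDirection (curl (u n s)) x + vorticityDirection (curl (u n s)) y‖ ≤
                  η ‖x - y‖) ∨
           (∃ (n : ℕ) (ρ M : ℝ), 0 < ρ ∧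
              ∀ z ∈ parabolicCylinder ρ (0 : ℝ × EuclideanSpace ℝ (Fin 3)),
                ‖curl (u n z.1) z.2‖ ≤ M) ∨
           (∃ (n : ℕ) (e : EuclideanSpace ℝ (Fin 3)) (ρ M : ℝ), (R n e = e ∨ R n e = -e) ∧
              0 < ρ ∧ ∀ z ∈ parabolicCylinder ρ (0 : ℝ × EuclideanSpace ℝ (Fin 3)),
                ∃ a : ℝ, ‖u n z.1 z.2 - a • e‖ ≤ M) ∨
           (∃ (n : ℕ) (e : EuclideanSpace ℝ (Fin 3)) (ρ M : ℝ), (R n e = e ∨ R n e = -e) ∧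
              0 < ρ ∧ ∀ z ∈ parabolicCylinder ρ (0 : ℝ × EuclideanSpace ℝ (Fin 3)),
                ∃ a : ℝ, ‖curl (u n z.1) z.2 - a • e‖ ≤ M) ∨
           (∃ (n : ℕ) (S : EuclideanSpace ℝ (Fin 3) ≃ₗᵢ[ℝ] EuclideanSpace ℝ (Fin 3))
              (b : EuclideanSpace ℝ (Fin 3)), S b = b ∧ b ≠ 0 ∧
              ∀ x, ‖u n (-1) x‖ ≤ ‖u n (-1) (S x + b)‖) ∨
           (∃ A : ℕ → (EuclideanSpace ℝ (Fin 3) ≃ₗᵢ[ℝ] EuclideanSpace ℝ (Fin 3)),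
              ∀ θ, ∀ t < 0, ∀ x,
                Tendsto (fun n => (A n).symm (u n t (A n (rotZ θ x))) -
                  rotZ θ ((A n).symm (u n t (A n x)))) atTop (𝓝 0)) ∨
           (∃ (S : EuclideanSpace ℝ (Fin 3) ≃ₗᵢ[ℝ] EuclideanSpace ℝ (Fin 3))
              (b : EuclideanSpace ℝ (Fin 3)), S b = b ∧ b ≠ 0 ∧
              ∀ x, Tendsto (fun n => ‖u n (-1) (S x + b)‖ - ‖u n (-1) x‖) atTop (𝓝 0)) ∨
           (∀ s < 0, ∀ t < 0, ∀ x, Tendsto (fun n => u n t x - u n s x) atTop (𝓝 0)) ∨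
           (∃ (A : ℕ → (EuclideanSpace ℝ (Fin 3) ≃ₗᵢ[ℝ] EuclideanSpace ℝ (Fin 3))) (α : ℕ → ℝ),
              Tendsto α atTop (𝓝 0) ∧ (∀ n, α n ≠ 0) ∧ ∀ n, ∀ t < 0, ∀ x,
                (A n).symm (u n t (A n (rotZ (α n) x))) =
                  rotZ (α n) ((A n).symm (u n t (A n x))))) := by
  obtain ⟨ε₀, hε₀, H⟩ := excludedStrata_windowSequences_v8
  refine ⟨ε₀, hε₀, fun C₀ => ?_⟩
  obtain ⟨κ, α₁, c₁, α₂, c₂, lam₁, β₁, β₂, hκ, hα₁, hc₁, hα₂, hc₂, hlam₁, hβ₁, hβ₂, HC⟩ := H C₀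
  refine ⟨κ, α₁, c₁, α₂, c₂, lam₁, β₁, β₂, hκ, hα₁, hc₁, hα₂, hc₂, hlam₁, hβ₁, hβ₂,
    fun {cmin cmax δ L ε c R u p d} hcmin hδ hε hW => ?_⟩
  have HC' := HC hcmin hδ hε hW
  simp only [not_or] at HC' ⊢
  obtain ⟨h0, h1, h2, h3, h4, h5, h6, h7, h8, h9, h10, h11, h12, h13, h14, h15, h16, h17, h18, h19,
    h20, h21, h22, h23, h24⟩ := HC'
  exact ⟨h0, h1, h2, h3, h4, h5, h6, h7, h8, h9, h10, h11, h12, h13, h14, h15, h16, h17, h18, h19,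
    h20, h21, h22, h23, h24,
    fun ⟨A, α, hα, hα0, hinv⟩ =>
      no_windowSequence_rotInvariant_vanishingAngle hcmin hδ hε hW A α hα hα0 hinv⟩

end Summit.NavierStokesRegularity.AngularGalerkinLadderExcludedStrataCensusV9
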